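import Summits.BirchSwinnertonDyer.Rank1Residual.Additive.ZpTowerSeam
import Literature.NumberTheory.EllipticCurves.SelmerPInftyRestriction
import HarnessLib

/-!
# `E_{K_n}(L̄)[p^∞]^{Γ_{K_n}} = 0` from `E(K_∞)[p^∞] = 0`: the fixed-point factor of the layer count is `1`
# (crux ♭T′ stmt-BirchSwinnertonDyer-26975, line `sigmacongruence`, brick (1b″-i) of the growth road to stub TS1)

Route `UniversalToricDescent`, lead prover `bsd-wall-utd-p1` g15. THEOREMS ONLY; `--supports stmt-BirchSwinnertonDyer-26975`.
BSD is not proved by any of this.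

The constant of `exists_finset_selmerAc_torsion_invariant_card_ge` (Theorems/…LayerRelaxedGrowth, p648146) carries the factor
`#{m : E_{K_n}[p^∞] | Γ_{K_n}-fixed}` computed over the LAYER FIELD `K_n = κ.layer n` and ITS algebraic closure. Along the
coefficient isomorphism `primaryBaseChangeEquiv : E[p^∞](K̄) ≃ E_{K_n}[p^∞](\overline{K_n})` (equivariant for `resGal`), and the
SEAM `galRange K_n = κ.layerSubgroup n` (`ZpTower.galRange_layer_eq_layerSubgroup`), these fixed points are the fixed points of
`Γ_n ⊇ ker κ` on `E[p^∞](K̄)`; so they vanish as soon as `E(K_∞)[p^∞] = E[p^∞]^{ker κ} = 0`: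
`natCard_fixed_baseChange_layer_eq_one`.

References: [GreenbergLNM1716] §3 Lemma 3.1 (p. 86); [SerreGaloisCohomology1997] II.§1.1.
-/

set_option autoImplicit false
-- the Theorems namespace of this sub repeats the summit name by design (D-0017 nested layout)
set_option linter.dupNamespace false

noncomputable section

open scoped Classical
open Literature.NumberTheory.EllipticCurves Field
  Summit.BirchSwinnertonDyer.Rank1Residual.Additive.ZpTower

namespace Summit.BirchSwinnertonDyer.BirchSwinnertonDyer.Theorems.UniversalToricDescentLayerFixedPoints

variable {K : Type} [Field K] [NumberField K] (W : WeierstrassCurve K) (p : ℕ) [Fact p.Prime] (κ : ZpExtension K p)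

/-- **`#E_{K_n}(\overline{K_n})[p^∞]^{Γ_{K_n}} = 1` when `E(K_∞)[p^∞] = 0`.** A `Γ_{K_n}`-fixed `m` pulls back along
`primaryBaseChangeEquiv` to a point of `E[p^∞](K̄)` fixed by `galRange K_n = Γ_n ⊇ ker κ`, hence to `0`.
[cite: GreenbergLNM1716, §3 Lemma 3.1 (p. 86)] [cite: SerreGaloisCohomology1997, II.§1.1] -/
theorem natCard_fixed_baseChange_layer_eq_one
    (hB : FixedPoints.addSubgroup κ.kerSubgroup (W.geomPrimaryTorsion p) = ⊥) (n : ℕ) :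
    Nat.card {m : (W.baseChange (κ.layer n)).geomPrimaryTorsion p |
      ∀ σ : absoluteGaloisGroup (κ.layer n), σ • m = m} = 1 := by
  rw [Nat.card_eq_one_iff_unique]
  refine ⟨⟨fun a b ↦ ?_⟩, ⟨⟨0, fun σ ↦ smul_zero σ⟩⟩⟩
  -- every fixed `m` is `0`
  have hzero : ∀ m : (W.baseChange (κ.layer n)).geomPrimaryTorsion p,
      (∀ σ : absoluteGaloisGroup (κ.layer n), σ • m = m) → m = 0 := by
    intro m hm
    set e := primaryBaseChangeEquiv (κ.layer n) W p with he
    set P := e.symm m with hP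
    have hmP : m = e P := by rw [hP, AddEquiv.apply_symm_apply]
    have hfix : P ∈ FixedPoints.addSubgroup κ.kerSubgroup (W.geomPrimaryTorsion p) := by
      intro τ
      have hτ : (τ : absoluteGaloisGroup K) ∈ galRange (K := K) (κ.layer n) := by
        rw [galRange_layer_eq_layerSubgroup κ n]
        exact κ.kerSubgroup_le_layerSubgroup n τ.2
      obtain ⟨σ, hσ⟩ := (mem_galRange_iff (κ.layer n) _).mp hτ
      have h1 : e (resGalToRange (K := K) (κ.layer n) σ • P) = e P := by
        rw [primaryBaseChangeEquiv_smul, ← hmP, hm σ]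
      have h2 : resGalToRange (K := K) (κ.layer n) σ • P = P := e.injective h1
      rw [Subgroup.smul_def] at h2 ⊢
      rw [show ((τ : κ.kerSubgroup) : absoluteGaloisGroup K) = (resGalToRange (K := K) (κ.layer n) σ : absoluteGaloisGroup K)
        from by rw [coe_resGalToRange, hσ]]
      exact h2
    rw [hB, AddSubgroup.mem_bot] at hfix
    rw [hmP, hfix, map_zero]
  exact Subtype.ext ((hzero a.1 a.2).trans (hzero b.1 b.2).symm)

end Summit.BirchSwinnertonDyer.BirchSwinnertonDyer.Theorems.UniversalToricDescentLayerFixedPoints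

end
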